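import Mathlib.Analysis.SpecialFunctions.SmoothTransition
import Mathlib.Analysis.SpecialFunctions.Sqrt
import Mathlib.Analysis.Calculus.Deriv.MeanValue
import Mathlib.Analysis.Calculus.Deriv.Slope
import Summits.SmoothPoincare4.SmoothPoincare4.Theorems.SymplecticOrigamiOrigamiFoldExistenceShadowPleatsDefs

/-!
# Stub `stub_outerCleanRecognitionChart` of line `shadow-pleats` for crux `OrigamiFoldExistence` — M:
# the RADIAL PROFILE of the cap map (item stmt-SmoothPoincare4-7844, route SymplecticOrigami; seat c3, S4''-chart worker)

Thirteenth helper file towards `stub_outerCleanRecognitionChart : OuterCleanRecognitionChart`.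
The map `Φ : S⁴ → M` of that statement inverts, off the chimney, a map `Ψ : M ∖ e₀(B₂) → S⁴`
which is `λ ∘ shadow` (`λ = liftS4 = σ_N⁻¹`) on the outer part above the plane `h = 1 − δ`.  On
the ROUND part `{h ≤ 1 − δ} ⊂ S⁴` one cannot use `λ ∘ shadow` (the upper band and the lower
hemisphere have the same shadows); the CAP MAP of file N replaces it by
`p ↦ R_N λ((4 / P(p₄)) · proj5 p)` (`R_N` the reflection in the equatorial hyperplane), which by
the inversion formula `R_N λ(4z/‖z‖²) = λ(z)` IS `λ ∘ proj5` on the band `{(1−δ)/2 ≤ p₄ < 1}` and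
sweeps the rest of the round part once over `S⁴ ∖ λ(B_ρ)`, provided the RADIAL PROFILE
`Q(t) = √(1 − t²) / P(t)` is strictly increasing on `[−1, 1)`.  This file is the one-variable
calculus of that profile (elementary; Mathlib's `Real.smoothTransition`):

* `capCut δ` — a smooth monotone cut-off, `0` below `(1−δ)/4`, `1` above `(1−δ)/2`;
* `capP δ t = (1 − t)(2 − capCut δ t · (1 − t))` — smooth, POSITIVE on `(−∞, 1)`, equal to
  `2(1 − t)` below `(1−δ)/4` (so that `4/P` is smooth through the south pole `t = −1`) and to
  `1 − t²` above `(1−δ)/2` (the band identity);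
* `capKey_neg` — the sign `P′(t)(1 − t²) + t P(t) < 0` on `(−1, 1)` (it is
  `(1−t)(−2 + χ(1−t)(2+t) − χ′(1−t)²(1+t))` with `χ′ ≥ 0`, and `χ > 0` only where `t > 0`);
* `capQ δ t = √(1 − t²) / capP δ t` — **`strictMonoOn_capQ`** (registered helper): strictly
  increasing on `[−1, 1)`, from `capQ (−1) = 0` through `capQ (1 − δ) = 1/ρ`,
  `ρ = √(1 − (1−δ)²)`; `exists_capQ_eq` (every value in `(0, 1/ρ]` is taken on `(−1, 1 − δ]`).

Sources: elementary calculus; the lead's `OuterClean-analysis-c3.md` §3 (O2)(d) ("`b̄ ≅ D_∞` by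
inversion fixing `∂B`").
-/

noncomputable section

-- the prescribed namespace `Summit.<P>.<Sub>.…` duplicates `SmoothPoincare4` (P = Sub)
set_option linter.dupNamespace false

open scoped ContDiff Topology
open Set Function Filter

namespace Summit.SmoothPoincare4.SmoothPoincare4.Theorems.OrigamiFoldExistence.ShadowPleats

/-! ### The cut-off -/

/-- The CUT-OFF `χ_δ`: `0` for `t ≤ (1−δ)/4`, `1` for `t ≥ (1−δ)/2`, monotone, smooth. -/
def capCut (δ t : ℝ) : ℝ := Real.smoothTransition ((t - (1 - δ) / 4) / ((1 - δ) / 4))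

section Cut

variable {δ : ℝ}

/-- The cut-off is smooth. -/
theorem contDiff_capCut (δ : ℝ) : ContDiff ℝ ∞ (capCut δ) :=
  Real.smoothTransition.contDiff.comp ((contDiff_id.sub contDiff_const).div_const _)

/-- The cut-off is non-negative. -/
theorem capCut_nonneg (δ t : ℝ) : 0 ≤ capCut δ t := Real.smoothTransition.nonneg _

/-- The cut-off is at most `1`. -/
theorem capCut_le_one (δ t : ℝ) : capCut δ t ≤ 1 := Real.smoothTransition.le_one _

/-- The cut-off is monotone (for `δ < 1`). -/
theorem monotone_capCut (hδ1 : δ < 1) : Monotone (capCut δ) := fun a b hab =>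
  Real.smoothTransition.monotone (div_le_div_of_nonneg_right (by linarith) (by linarith))

/-- Below `(1−δ)/4` the cut-off vanishes. -/
theorem capCut_of_le (hδ1 : δ < 1) {t : ℝ} (ht : t ≤ (1 - δ) / 4) : capCut δ t = 0 :=
  Real.smoothTransition.zero_of_nonpos (div_nonpos_of_nonpos_of_nonneg (by linarith) (by linarith))

/-- Above `(1−δ)/2` the cut-off is `1`. -/
theorem capCut_of_ge (hδ1 : δ < 1) {t : ℝ} (ht : (1 - δ) / 2 ≤ t) : capCut δ t = 1 :=
  Real.smoothTransition.one_of_one_le ((one_le_div (by linarith)).2 (by linarith))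

/-- Where the cut-off is positive, `t > 0`. -/
theorem pos_of_capCut_pos (hδ1 : δ < 1) {t : ℝ} (ht : 0 < capCut δ t) : 0 < t := by
  by_contra hle
  have := capCut_of_le hδ1 (show t ≤ (1 - δ) / 4 by linarith [not_lt.1 hle])
  linarith

/-- The cut-off is differentiable with non-negative derivative. -/
theorem hasDerivAt_capCut (hδ1 : δ < 1) (t : ℝ) :
    HasDerivAt (capCut δ) (deriv (capCut δ) t) t ∧ 0 ≤ deriv (capCut δ) t :=
  ⟨((contDiff_capCut δ).differentiable (by simp) t).hasDerivAt, (monotone_capCut hδ1).deriv_nonneg⟩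

end Cut

/-! ### The profile `P` -/

/-- The PROFILE `P_δ(t) = (1 − t)(2 − χ_δ(t)(1 − t))`. -/
def capP (δ t : ℝ) : ℝ := (1 - t) * (2 - capCut δ t * (1 - t))

section Profile

variable {δ : ℝ}

/-- The profile is smooth. -/
theorem contDiff_capP (δ : ℝ) : ContDiff ℝ ∞ (capP δ) :=
  (contDiff_const.sub contDiff_id).mul (contDiff_const.sub ((contDiff_capCut δ).mul (contDiff_const.sub contDiff_id)))

/-- The profile is continuous. -/
theorem continuous_capP (δ : ℝ) : Continuous (capP δ) := (contDiff_capP δ).continuous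

/-- The second factor of the profile is at least `1` on `(−∞, 1)`. -/
theorem one_le_capP_factor (hδ1 : δ < 1) {t : ℝ} (ht : t < 1) : 1 ≤ 2 - capCut δ t * (1 - t) := by
  by_cases h0 : capCut δ t = 0
  · rw [h0]; linarith
  · have hpos : 0 < t := pos_of_capCut_pos hδ1 (lt_of_le_of_ne (capCut_nonneg δ t) (Ne.symm h0))
    have h1 : capCut δ t * (1 - t) ≤ 1 - t := by
      have := capCut_le_one δ t
      nlinarith
    linarith

/-- **The profile is positive on `(−∞, 1)`.** -/
theorem capP_pos (hδ1 : δ < 1) {t : ℝ} (ht : t < 1) : 0 < capP δ t := by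
  have h1 := one_le_capP_factor hδ1 ht
  unfold capP
  exact mul_pos (by linarith) (by linarith)

/-- Below `(1−δ)/4` the profile is `2(1 − t)`. -/
theorem capP_of_le (hδ1 : δ < 1) {t : ℝ} (ht : t ≤ (1 - δ) / 4) : capP δ t = 2 * (1 - t) := by
  rw [capP, capCut_of_le hδ1 ht]; ring

/-- **Above `(1−δ)/2` the profile is `1 − t²`** (the band identity). -/
theorem capP_of_ge (hδ1 : δ < 1) {t : ℝ} (ht : (1 - δ) / 2 ≤ t) : capP δ t = 1 - t ^ 2 := by
  rw [capP, capCut_of_ge hδ1 ht]; ring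

/-- The derivative of the profile. -/
theorem hasDerivAt_capP (hδ1 : δ < 1) (t : ℝ) :
    HasDerivAt (capP δ) (-2 + 2 * capCut δ t * (1 - t) - deriv (capCut δ) t * (1 - t) ^ 2) t := by
  obtain ⟨hχ, -⟩ := hasDerivAt_capCut hδ1 t
  have h1 : HasDerivAt (fun s : ℝ => 1 - s) (-1) t := by simpa using (hasDerivAt_id t).const_sub 1
  have h2 : HasDerivAt (fun s : ℝ => capCut δ s * (1 - s)) (deriv (capCut δ) t * (1 - t) + capCut δ t * (-1)) t :=
    hχ.mul h1
  have h3 : HasDerivAt (fun s : ℝ => 2 - capCut δ s * (1 - s)) (-(deriv (capCut δ) t * (1 - t) + capCut δ t * (-1))) t := by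
    simpa using h2.const_sub 2
  have h4 : HasDerivAt (fun s : ℝ => (1 - s) * (2 - capCut δ s * (1 - s)))
      (-1 * (2 - capCut δ t * (1 - t)) + (1 - t) * -(deriv (capCut δ) t * (1 - t) + capCut δ t * (-1))) t :=
    h1.mul h3
  have hfun : (fun s : ℝ => (1 - s) * (2 - capCut δ s * (1 - s))) = capP δ := rfl
  rw [hfun] at h4
  exact h4.congr_deriv (by ring)

/-- **THE KEY SIGN**: `P′(t)(1 − t²) + t P(t) < 0` on `(−1, 1)`. -/
theorem capKey_neg (hδ1 : δ < 1) {t : ℝ} (ht1 : -1 < t) (ht2 : t < 1) :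
    (-2 + 2 * capCut δ t * (1 - t) - deriv (capCut δ) t * (1 - t) ^ 2) * (1 - t ^ 2) + t * capP δ t < 0 := by
  obtain ⟨-, hχ'⟩ := hasDerivAt_capCut hδ1 t
  set χ := capCut δ t with hχdef
  set χ' := deriv (capCut δ) t with hχ'def
  have hχ0 : 0 ≤ χ := capCut_nonneg δ t
  have hχ1 : χ ≤ 1 := capCut_le_one δ t
  have hfac : (-2 + 2 * χ * (1 - t) - χ' * (1 - t) ^ 2) * (1 - t ^ 2) + t * capP δ t =
      (1 - t) * (-2 + χ * (1 - t) * (2 + t) - χ' * (1 - t) ^ 2 * (1 + t)) := by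
    rw [capP, ← hχdef]; ring
  rw [hfac]
  have h1t : 0 < 1 - t := by linarith
  have hbr : -2 + χ * (1 - t) * (2 + t) - χ' * (1 - t) ^ 2 * (1 + t) < 0 := by
    have hA : 0 ≤ χ' * (1 - t) ^ 2 * (1 + t) := by
      have : 0 ≤ (1 - t) ^ 2 * (1 + t) := mul_nonneg (sq_nonneg _) (by linarith)
      nlinarith
    have hB : χ * (1 - t) * (2 + t) < 2 := by
      by_cases h0 : χ = 0
      · rw [h0]; norm_num
      · have hpos : 0 < t := pos_of_capCut_pos hδ1 (lt_of_le_of_ne hχ0 (Ne.symm h0))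
        have h2 : (1 - t) * (2 + t) < 2 := by nlinarith
        have h3 : 0 ≤ (1 - t) * (2 + t) := by nlinarith
        calc χ * (1 - t) * (2 + t) = χ * ((1 - t) * (2 + t)) := by ring
          _ ≤ 1 * ((1 - t) * (2 + t)) := by gcongr
          _ < 2 := by linarith
    linarith
  exact mul_neg_of_pos_of_neg h1t hbr

end Profile

/-! ### The radial profile `Q = √(1 − t²) / P` -/

/-- The RADIAL PROFILE `Q_δ(t) = √(1 − t²) / P_δ(t)` of the cap map. -/
def capQ (δ t : ℝ) : ℝ := Real.sqrt (1 - t ^ 2) / capP δ t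

section Radial

variable {δ : ℝ}

/-- `Q(−1) = 0`. -/
theorem capQ_neg_one (δ : ℝ) : capQ δ (-1) = 0 := by simp [capQ]

/-- `Q` is non-negative on `(−∞, 1)`. -/
theorem capQ_nonneg (hδ1 : δ < 1) {t : ℝ} (ht : t < 1) : 0 ≤ capQ δ t :=
  div_nonneg (Real.sqrt_nonneg _) (capP_pos hδ1 ht).le

/-- `Q` is positive on `(−1, 1)`. -/
theorem capQ_pos (hδ1 : δ < 1) {t : ℝ} (ht1 : -1 < t) (ht2 : t < 1) : 0 < capQ δ t :=
  div_pos (Real.sqrt_pos.2 (by nlinarith)) (capP_pos hδ1 ht2)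

/-- `Q` is continuous on `(−∞, 1)`. -/
theorem continuousOn_capQ (hδ1 : δ < 1) : ContinuousOn (capQ δ) (Iio 1) :=
  ((continuous_const.sub (continuous_id.pow 2)).sqrt.continuousOn).div (continuous_capP δ).continuousOn
    fun _ ht => (capP_pos hδ1 ht).ne'

/-- The derivative of `Q` on `(−1, 1)` is positive. -/
theorem exists_hasDerivAt_capQ_pos (hδ1 : δ < 1) {t : ℝ} (ht1 : -1 < t) (ht2 : t < 1) :
    ∃ q' : ℝ, HasDerivAt (capQ δ) q' t ∧ 0 < q' := by
  have h1t : 0 < 1 - t ^ 2 := by nlinarith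
  have hsq : 0 < Real.sqrt (1 - t ^ 2) := Real.sqrt_pos.2 h1t
  have hP := capP_pos hδ1 ht2
  have hu : HasDerivAt (fun s : ℝ => Real.sqrt (1 - s ^ 2)) (-(2 * t) / (2 * Real.sqrt (1 - t ^ 2))) t := by
    have h0 : HasDerivAt (fun s : ℝ => 1 - s ^ 2) (-(2 * t)) t := by
      simpa using ((hasDerivAt_id t).pow 2).const_sub 1
    exact h0.sqrt h1t.ne'
  have hv := hasDerivAt_capP hδ1 t
  set P' := -2 + 2 * capCut δ t * (1 - t) - deriv (capCut δ) t * (1 - t) ^ 2 with hP'def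
  have hkey : P' * (1 - t ^ 2) + t * capP δ t < 0 := capKey_neg hδ1 ht1 ht2
  have hQ : HasDerivAt (capQ δ) ((-(2 * t) / (2 * Real.sqrt (1 - t ^ 2)) * capP δ t - Real.sqrt (1 - t ^ 2) * P') / capP δ t ^ 2) t :=
    hu.div hv hP.ne'
  refine ⟨_, hQ, div_pos ?_ (pow_pos hP 2)⟩
  -- the numerator is `-(P′(1 − t²) + t P)/√(1 − t²) > 0`
  have hnum : (-(2 * t) / (2 * Real.sqrt (1 - t ^ 2)) * capP δ t - Real.sqrt (1 - t ^ 2) * P') * Real.sqrt (1 - t ^ 2) =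
      -(P' * (1 - t ^ 2) + t * capP δ t) := by
    have hss : Real.sqrt (1 - t ^ 2) * Real.sqrt (1 - t ^ 2) = 1 - t ^ 2 := Real.mul_self_sqrt h1t.le
    have hne : Real.sqrt (1 - t ^ 2) ≠ 0 := hsq.ne'
    have h1 : -(2 * t) / (2 * Real.sqrt (1 - t ^ 2)) * capP δ t * Real.sqrt (1 - t ^ 2) = -(t * capP δ t) := by
      field_simp
    calc (-(2 * t) / (2 * Real.sqrt (1 - t ^ 2)) * capP δ t - Real.sqrt (1 - t ^ 2) * P') * Real.sqrt (1 - t ^ 2)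
        = -(2 * t) / (2 * Real.sqrt (1 - t ^ 2)) * capP δ t * Real.sqrt (1 - t ^ 2) -
            Real.sqrt (1 - t ^ 2) * Real.sqrt (1 - t ^ 2) * P' := by ring
      _ = -(t * capP δ t) - (1 - t ^ 2) * P' := by rw [h1, hss]
      _ = -(P' * (1 - t ^ 2) + t * capP δ t) := by ring
  have hpos : 0 < (-(2 * t) / (2 * Real.sqrt (1 - t ^ 2)) * capP δ t - Real.sqrt (1 - t ^ 2) * P') * Real.sqrt (1 - t ^ 2) := by
    rw [hnum]; linarith
  exact pos_of_mul_pos_left hpos hsq.le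

/-- **THE RADIAL PROFILE IS STRICTLY INCREASING ON `[−1, 1)`** (registered helper of file M).
[folklore] -/
theorem strictMonoOn_capQ (hδ1 : δ < 1) : StrictMonoOn (capQ δ) (Ico (-1) 1) := by
  refine strictMonoOn_of_deriv_pos (convex_Ico (-1) 1) ((continuousOn_capQ hδ1).mono fun t ht => ht.2) fun t ht => ?_
  rw [interior_Ico] at ht
  obtain ⟨q', hq', hpos⟩ := exists_hasDerivAt_capQ_pos hδ1 ht.1 ht.2
  rwa [hq'.deriv]

/-- `Q(1 − δ) = 1/ρ`, `ρ = √(1 − (1−δ)²)`. -/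
theorem capQ_one_sub (hδ : 0 < δ) (hδ1 : δ < 1) : capQ δ (1 - δ) = (Real.sqrt (1 - (1 - δ) ^ 2))⁻¹ := by
  have hρ2 : 0 < 1 - (1 - δ) ^ 2 := by nlinarith
  have hρ : 0 < Real.sqrt (1 - (1 - δ) ^ 2) := Real.sqrt_pos.2 hρ2
  rw [capQ, capP_of_ge hδ1 (by linarith)]
  set r := Real.sqrt (1 - (1 - δ) ^ 2) with hr
  have hss : r * r = 1 - (1 - δ) ^ 2 := Real.mul_self_sqrt hρ2.le
  rw [← hss]
  field_simp

/-- On `[−1, 1 − δ]` the radial profile is at most `1/ρ`. -/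
theorem capQ_le (hδ : 0 < δ) (hδ1 : δ < 1) {t : ℝ} (ht1 : -1 ≤ t) (ht2 : t ≤ 1 - δ) :
    capQ δ t ≤ (Real.sqrt (1 - (1 - δ) ^ 2))⁻¹ := by
  rw [← capQ_one_sub hδ hδ1]
  exact (strictMonoOn_capQ hδ1).monotoneOn ⟨ht1, by linarith⟩ ⟨by linarith, by linarith⟩ ht2

/-- **Every value in `(0, 1/ρ]` is taken on `(−1, 1 − δ]`** (intermediate values). -/
theorem exists_capQ_eq (hδ : 0 < δ) (hδ1 : δ < 1) {c : ℝ} (hc0 : 0 < c) (hc1 : c ≤ (Real.sqrt (1 - (1 - δ) ^ 2))⁻¹) :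
    ∃ t : ℝ, -1 < t ∧ t ≤ 1 - δ ∧ capQ δ t = c := by
  have hcont : ContinuousOn (capQ δ) (Icc (-1) (1 - δ)) := (continuousOn_capQ hδ1).mono fun t ht => by
    show t < 1; linarith [ht.2]
  have hlo : capQ δ (-1) ≤ c := by rw [capQ_neg_one]; exact hc0.le
  have hhi : c ≤ capQ δ (1 - δ) := by rw [capQ_one_sub hδ hδ1]; exact hc1
  obtain ⟨t, ht, htc⟩ := intermediate_value_Icc (by linarith : (-1 : ℝ) ≤ 1 - δ) hcont ⟨hlo, hhi⟩
  refine ⟨t, lt_of_le_of_ne ht.1 fun heq => ?_, ht.2, htc⟩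
  rw [← heq, capQ_neg_one] at htc
  exact hc0.ne htc

end Radial

end Summit.SmoothPoincare4.SmoothPoincare4.Theorems.OrigamiFoldExistence.ShadowPleats

end
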